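import Summits.ValiantsHypothesis.ValiantsHypothesis.Theorems.GrenetZeonDualUnipotentThreeHalvesLongMassTriangular

/-!
# Row r6 (all-powers half) in the kernel — the line-wise Gerstenhaber theorem: lines in the directions of the powers of ONE
# principal nilpotent force strict upper-triangularity, hence (c)-cheapness

Crux workfile of val-idea-26 **g7** (planner-val-idea-26-g7-0; lens «Gerstenhaber-type nilpotent-subspace structure theory»; crux
`stmt-ValiantsHypothesis-24318`).  **Honest status: VP ≠ VNP is NOT proved; crux 24318 `DualUnipotentThreeHalves` is OPEN; its one open
statement of record is (c) `SlowCore.LongMassSlowLawInv` (`Lines/slow_core.lean` rev 4).  This file proves NO case of (c).**  It moves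
crit-7's row **r6** («principal + square / all powers ⇒ triangularisable ⇒ (c)-cheap», CRITIC-w2-g3 rev 5 §rows: «quotation-level
(Omladič 2014 Cor 8, acq-14327); in-Lean M») from quotation level INTO THE KERNEL in its ALL-POWERS form (Gerstenhaber 1958 Thm 2 /
Mathes–Omladič–Radjavi, LAA 149 (1991) §4), in a LINE-WISE strengthening, with a new two-step proof (torus initial form + weighted cycle):

* ★ `strictUpper_of_nilpotent_lines` — if `A + t·J^a` is nilpotent for every `t ∈ ℂ` and every `a ≥ 1` (`J = Σ_i E_{i,i+1}` the
  principal nilpotent, `J^a = shiftPow ℂ b a`, cf. `shiftPow_eq_pow`), then `A` is STRICTLY UPPER TRIANGULAR — in the same basis.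
  Only the `b − 1` LINES through `A` are used; `A` need not lie in a nilpotent space together with the `J^a`.
* ★ `conj_strictUpper_of_nilpotent_lines` / `space_triangularised_by_principal_powers` — the same for any principal nilpotent
  `Q = P⁻¹JP`: a nilpotent set closed under `+ t·Q^a` is conjugated into `𝔫_b` by `P` (Gerstenhaber's corollary, constructively).
* ★ `relCert_of_principal_powers` / `relCert_of_shift_powers` — ROW r6 in (c)'s currency: an affine pencil whose values stay nilpotent
  along all lines `N(x) + t·Q^a` has `RelCert n m N (3·(⌊√n⌋·m))` (✓ g6 row r2 `Theorems.GrenetZeon.TriangularRow.relCert_of_values_triangularisable`).  So a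
  (c)-violator family never carries all powers of a principal nilpotent in its direction space (discard test D6, all-powers half).

NOT covered: Omladič's sharpening (only `J` and `J²` needed, LMA 62 (2014) Cor. 8) — step (2) below uses the direction `J^{(R+1)d}`.

## Proof (paper, 12 lines; kernel below)
Let `d ≥ 0` be the deepest diagonal `{i − j = d}` on or below the main diagonal carrying a nonzero entry of `A` (induction
`diag_step`, assembled in `strictUpper_of_lines`).
(1) TORUS / INITIAL FORM (`diagPart_lines`): with `D(τ) = diag(τ^i)`, `Q(τ) := τ^d·D(τ)⁻¹(A + t·τ^{−d−a}J^a)D(τ)` has POLYNOMIAL entries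
`τ^{d+j−i}A_{ij} + t[j = i+a]`, and for `τ ≠ 0` it is a scalar multiple of a conjugate of a matrix with vanishing `b`-th power; so every
entry of `Q(τ)^b` is a polynomial in `τ` vanishing on `ℂ∖{0}`, hence identically (`Polynomial.eq_zero_of_infinite_isRoot`), hence at
`τ = 0`, where `Q(0) = X_d + tJ^a` with `X_d` the diagonal-`d` part of `A`.  For `d = 0`, `X_0 = diag(A_ii)` nilpotent ⇒ `A_ii = 0`.
(2) WEIGHTED CYCLE (`eq_zero_of_diag_lines`, `d ≥ 1`): let `c` be the smallest column with weight `w(c) := A_{c+d,c} ≠ 0` and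
`c, c+d, …, c+Rd` the maximal run of nonzero weights (`w(c+(R+1)d) = 0` or out of range).  `M := X_d + J^{(R+1)d}` is block upper
triangular for the labelling `{other residue classes mod d} ∪ {class of c below c} ↦ 0`, `{c, …, c+(R+1)d} ↦ 1`, `{class of c above} ↦ 2`
(`X_d` raises indices by `d` inside a class and kills column `c+(R+1)d` and the columns `< c`; `J^{(R+1)d}` lowers by `(R+1)d` inside a
class), so `M^b = 0` forces the diagonal block on `{c+kd : k ≤ R+1}` to have vanishing `b`-th power (`submatrix_mul_of_blockTriangular`).
That block is the weighted `(R+2)`-cycle `e_k ↦ w(c+kd)e_{k+1}` (`k ≤ R`), `e_{R+1} ↦ e_0`, a permuted diagonal matrix with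
`det = ±∏ w ≠ 0` (`Matrix.det_permute`, `finRotate`) — contradiction.  ∎

Cell datum used this cycle (val-heavytop-census): CENSUS-GRID v0.7a §B / CENSUS `W(T_4)@(5,10)` row (species bookkeeping: every censused
irreducible species so far is a CONE over a triangularisable core plus returns; none contains `ℂ[Q]Q` for a principal `Q`, consistent
with this row discarding such families at sight).  No kit jobs (kit 0).  References: M. Gerstenhaber, *On nilalgebras and linear varieties
of nilpotent matrices I*, Amer. J. Math. 80 (1958) 614–622, Thm 2; B. Mathes, M. Omladič, H. Radjavi, *Linear spaces of nilpotent
matrices*, LAA 149 (1991) 215–225, §4; M. Omladič, LMA 62 (2014), Cor. 8 (the `J,J²` form, not formalised); S. Calamai, E. Rubei,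
arXiv:2508.06653 (2025), Lemma 2.4 (unipotent Toeplitz gauge — not needed here).
-/


namespace Summit.ValiantsHypothesis.ValiantsHypothesis.Cruxes.DualUnipotentThreeHalves.PrincipalPowers

open Matrix Polynomial
open scoped BigOperators

/-- `shiftPow R b a = J^a` for the principal nilpotent `J = Σ_i E_{i,i+1} ∈ M_b(R)`: the entry is `1` at `(i, i+a)` and `0` elsewhere. -/
def shiftPow (R : Type*) [Zero R] [One R] (b a : ℕ) : Matrix (Fin b) (Fin b) R :=
  fun i j => if (j : ℕ) = i + a then 1 else 0

theorem shiftPow_apply {R : Type*} [Zero R] [One R] (b a : ℕ) (i j : Fin b) :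
    shiftPow R b a i j = if (j : ℕ) = i + a then 1 else 0 := rfl

theorem shiftPow_map {R S : Type*} [Zero R] [One R] [Zero S] [One S] (f : R → S) (hf0 : f 0 = 0) (hf1 : f 1 = 1)
    (b a : ℕ) : (shiftPow R b a).map f = shiftPow S b a := by
  ext i j
  simp only [map_apply, shiftPow_apply]
  split_ifs <;> simp [hf0, hf1]

/-- `J^a · J = J^{a+1}`. -/
theorem shiftPow_mul_one {R : Type*} [Semiring R] (b a : ℕ) :
    shiftPow R b a * shiftPow R b 1 = shiftPow R b (a + 1) := by
  ext i j
  rw [mul_apply, shiftPow_apply]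
  by_cases hia : (i : ℕ) + a < b
  · rw [Finset.sum_eq_single ⟨(i : ℕ) + a, hia⟩]
    · simp only [shiftPow_apply]
      simp [add_assoc]
    · intro l _ hl
      have : ¬ ((l : ℕ) = i + a) := fun h => hl (Fin.ext (by simpa using h))
      rw [shiftPow_apply, if_neg this, zero_mul]
    · intro h; exact absurd (Finset.mem_univ _) h
  · rw [if_neg (by omega)]
    apply Finset.sum_eq_zero
    intro l _
    have : ¬ ((l : ℕ) = i + a) := by have := l.isLt; omega
    rw [shiftPow_apply, if_neg this, zero_mul]

/-- `shiftPow R b a = (shiftPow R b 1)^a` — so the hypotheses below are literally about the powers of ONE principal nilpotent. -/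
theorem shiftPow_eq_pow {R : Type*} [Semiring R] (b a : ℕ) : shiftPow R b a = (shiftPow R b 1) ^ a := by
  induction a with
  | zero =>
    ext i j
    simp only [shiftPow_apply, add_zero, pow_zero, one_apply]
    by_cases h : i = j
    · subst h; simp
    · rw [if_neg (fun h' => h (Fin.ext h'.symm)), if_neg h]
  | succ a ih => rw [pow_succ, ← ih, shiftPow_mul_one]

/-- The diagonal-`d` part of `A` (entries with `i = j + d`). -/
def diagPart {b : ℕ} (A : Matrix (Fin b) (Fin b) ℂ) (d : ℕ) : Matrix (Fin b) (Fin b) ℂ :=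
  fun i j => if (i : ℕ) = j + d then A i j else 0

theorem diagPart_apply {b : ℕ} (A : Matrix (Fin b) (Fin b) ℂ) (d : ℕ) (i j : Fin b) :
    diagPart A d i j = if (i : ℕ) = j + d then A i j else 0 := rfl

/-- Powers of a conjugate when `D * D' = 1`. -/
theorem conj_pow {b : ℕ} (D D' B : Matrix (Fin b) (Fin b) ℂ) (h : D * D' = 1) (s : ℕ) :
    (D' * B * D) ^ s = D' * B ^ s * D := by
  induction s with
  | zero =>
    rw [pow_zero, pow_zero, Matrix.mul_one]
    -- D' * D = 1 from D * D' = 1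
    have : D' * D = 1 := mul_eq_one_comm.mp h
    rw [this]
  | succ s ih =>
    rw [pow_succ, ih, pow_succ]
    simp only [Matrix.mul_assoc]
    congr 1
    rw [← Matrix.mul_assoc D, h, Matrix.one_mul, ← Matrix.mul_assoc]

/-- Entry of a two-sided diagonal scaling. -/
theorem diag_conj_apply {b : ℕ} (u v : Fin b → ℂ) (B : Matrix (Fin b) (Fin b) ℂ) (i j : Fin b) :
    (diagonal u * B * diagonal v) i j = u i * B i j * v j := by
  simp only [Matrix.mul_diagonal, Matrix.diagonal_mul]

/-- **Torus / initial-form step.**  If nothing of `A` lies strictly below the diagonal `d` and every line `A + t·J^a`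
(`a ≥ 1`) consists of matrices with vanishing `b`-th power, then the same holds with `A` replaced by its diagonal-`d` part.
(`Q(τ) := τ^d·D(τ)⁻¹(A + tτ^{-d-a}J^a)D(τ)`, `D(τ) = diag(τ^i)`, has polynomial entries, `Q(τ)^b = 0` for `τ ≠ 0`, hence
identically, hence at `τ = 0`, where `Q(0) = X_d + tJ^a`.) -/
theorem diagPart_lines {b : ℕ} (A : Matrix (Fin b) (Fin b) ℂ) (d : ℕ)
    (hd : ∀ i j : Fin b, (j : ℕ) + d < i → A i j = 0)
    (hA : ∀ a : ℕ, 1 ≤ a → ∀ t : ℂ, (A + t • shiftPow ℂ b a) ^ b = 0) :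
    ∀ a : ℕ, 1 ≤ a → ∀ t : ℂ, (diagPart A d + t • shiftPow ℂ b a) ^ b = 0 := by
  intro a ha t
  let Q : Matrix (Fin b) (Fin b) ℂ[X] :=
    fun i j => Polynomial.C (A i j) * X ^ (d + j - i) + Polynomial.C (t * shiftPow ℂ b a i j)
  have hQap : ∀ i j : Fin b, Q i j = Polynomial.C (A i j) * X ^ (d + j - i) + Polynomial.C (t * shiftPow ℂ b a i j) :=
    fun _ _ => rfl
  -- (1) for τ ≠ 0, Q(τ)^b = 0
  have h1 : ∀ τ : ℂ, τ ≠ 0 → (Q.map (Polynomial.evalRingHom τ)) ^ b = 0 := by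
    intro τ hτ
    have hDD' : (diagonal fun i : Fin b => τ ^ (i : ℕ)) * (diagonal fun i : Fin b => τ⁻¹ ^ (i : ℕ)) = 1 := by
      have : (fun i : Fin b => τ ^ (i : ℕ) * τ⁻¹ ^ (i : ℕ)) = fun _ => 1 :=
        funext fun i => by rw [← mul_pow, mul_inv_cancel₀ hτ, one_pow]
      rw [diagonal_mul_diagonal, this, diagonal_one]
    have hQ : Q.map (Polynomial.evalRingHom τ) =
        (τ ^ d) • ((diagonal fun i : Fin b => τ⁻¹ ^ (i : ℕ)) * (A + (t * τ⁻¹ ^ (d + a)) • shiftPow ℂ b a) *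
          (diagonal fun i : Fin b => τ ^ (i : ℕ))) := by
      apply Matrix.ext; intro i j
      rw [Matrix.smul_apply, diag_conj_apply, Matrix.add_apply, Matrix.smul_apply, smul_eq_mul, smul_eq_mul,
        Matrix.map_apply, hQap]
      simp only [Polynomial.coe_evalRingHom, Polynomial.eval_add, Polynomial.eval_mul, Polynomial.eval_C,
        Polynomial.eval_pow, Polynomial.eval_X]
      by_cases hij : (j : ℕ) + d < i
      · -- strictly below the diagonal d: `A i j = 0` and `J^a i j = 0`
        have hne : ¬ ((j : ℕ) = i + a) := by omega
        rw [hd i j hij, shiftPow_apply, if_neg hne]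
        ring
      · obtain ⟨k, hk⟩ : ∃ k : ℕ, d + j = i + k := ⟨d + j - i, by omega⟩
        have hexp : d + (j : ℕ) - i = k := by omega
        rw [hexp]
        have key1 : τ ^ d * τ ^ (j : ℕ) * τ⁻¹ ^ (i : ℕ) = τ ^ k := by
          rw [← pow_add, hk, pow_add, mul_right_comm, ← mul_pow, mul_inv_cancel₀ hτ, one_pow, one_mul]
        by_cases hja : (j : ℕ) = i + a
        · have key3 : τ ^ d * τ ^ (j : ℕ) * (τ⁻¹ ^ (i : ℕ) * τ⁻¹ ^ (d + a)) = 1 := by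
            rw [← pow_add, ← pow_add, hja, show d + ((i : ℕ) + a) = (i : ℕ) + (d + a) by ring, ← mul_pow,
              mul_inv_cancel₀ hτ, one_pow]
          symm
          calc τ ^ d * (τ⁻¹ ^ (i : ℕ) * (A i j + t * τ⁻¹ ^ (d + a) * shiftPow ℂ b a i j) * τ ^ (j : ℕ))
              = A i j * (τ ^ d * τ ^ (j : ℕ) * τ⁻¹ ^ (i : ℕ))
                + t * shiftPow ℂ b a i j * (τ ^ d * τ ^ (j : ℕ) * (τ⁻¹ ^ (i : ℕ) * τ⁻¹ ^ (d + a))) := by ring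
            _ = A i j * τ ^ k + t * shiftPow ℂ b a i j := by rw [key1, key3, mul_one]
        · rw [shiftPow_apply, if_neg hja, mul_zero, mul_zero, add_zero, add_zero]
          symm
          calc τ ^ d * (τ⁻¹ ^ (i : ℕ) * (A i j) * τ ^ (j : ℕ))
              = A i j * (τ ^ d * τ ^ (j : ℕ) * τ⁻¹ ^ (i : ℕ)) := by ring
            _ = A i j * τ ^ k := by rw [key1]
    have hB : (A + (t * τ⁻¹ ^ (d + a)) • shiftPow ℂ b a) ^ b = 0 := hA a ha _
    rw [hQ, _root_.smul_pow, conj_pow _ _ _ hDD', hB, Matrix.mul_zero, Matrix.zero_mul, smul_zero]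
  -- (2) hence `Q^b = 0` as a polynomial matrix (each entry has infinitely many roots)
  have h2 : Q ^ b = 0 := by
    apply Matrix.ext; intro i j
    apply Polynomial.eq_zero_of_infinite_isRoot
    apply Set.Infinite.mono (s := {τ : ℂ | τ ≠ 0})
    · intro τ hτ
      simp only [Set.mem_setOf_eq, Polynomial.IsRoot.def]
      have key : ((Q ^ b).map (Polynomial.evalRingHom τ)) i j = ((Q.map (Polynomial.evalRingHom τ)) ^ b) i j := by
        rw [Matrix.map_pow]
      rw [h1 τ hτ, Matrix.zero_apply, Matrix.map_apply, Polynomial.coe_evalRingHom] at key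
      exact key
    · exact (Set.finite_singleton (0 : ℂ)).infinite_compl.mono (fun τ hτ => hτ)
  -- (3) evaluate at `τ = 0`
  have h3 : Q.map (Polynomial.evalRingHom 0) = diagPart A d + t • shiftPow ℂ b a := by
    apply Matrix.ext; intro i j
    rw [Matrix.add_apply, Matrix.smul_apply, smul_eq_mul, diagPart_apply, Matrix.map_apply, hQap]
    simp only [Polynomial.coe_evalRingHom, Polynomial.eval_add, Polynomial.eval_mul, Polynomial.eval_C,
      Polynomial.eval_pow, Polynomial.eval_X]
    by_cases hij : (i : ℕ) = j + d
    · rw [if_pos hij, show d + (j : ℕ) - i = 0 by omega, pow_zero, mul_one]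
    · rw [if_neg hij]
      by_cases hlt : (j : ℕ) + d < i
      · rw [hd i j hlt, zero_mul]
      · rw [zero_pow (by omega), mul_zero]
  have := congrArg (fun M : Matrix (Fin b) (Fin b) ℂ[X] => M.map (Polynomial.evalRingHom 0)) h2
  simp only [Matrix.map_pow, h3] at this
  simpa using this

/-! ## The weighted-cycle step -/

/-- Products of block-triangular matrices restrict to a diagonal block along an injective parametrisation `f` of that block. -/
theorem submatrix_mul_of_blockTriangular {b r : ℕ} {lab : Fin b → ℕ} {f : Fin r → Fin b} (hf : Function.Injective f)
    (hf1 : ∀ k, lab (f k) = 1) (h1f : ∀ l, lab l = 1 → ∃ k, f k = l)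
    (P Q : Matrix (Fin b) (Fin b) ℂ) (hP : P.BlockTriangular lab) (hQ : Q.BlockTriangular lab) :
    (P * Q).submatrix f f = P.submatrix f f * Q.submatrix f f := by
  classical
  ext p q
  simp only [submatrix_apply, Matrix.mul_apply]
  have himg : ∑ k : Fin r, P (f p) (f k) * Q (f k) (f q) = ∑ l ∈ Finset.univ.image f, P (f p) l * Q l (f q) := by
    rw [Finset.sum_image (fun x _ y _ h => hf h)]
  rw [himg]
  symm
  apply Finset.sum_subset (Finset.subset_univ _)
  intro l _ hl
  have hl1 : lab l ≠ 1 := by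
    intro h
    obtain ⟨k, hk⟩ := h1f l h
    exact hl (Finset.mem_image.mpr ⟨k, Finset.mem_univ _, hk⟩)
  rcases Nat.lt_or_gt_of_ne hl1 with hlt | hgt
  · rw [hP (show lab l < lab (f p) by rw [hf1]; exact hlt), zero_mul]
  · rw [hQ (show lab (f q) < lab l by rw [hf1]; exact hgt), mul_zero]

/-- **Weighted-cycle step.**  A matrix supported on ONE sub-diagonal `d ≥ 1` all of whose lines `X + J^a` (`a ≥ 1`) have
vanishing `b`-th power is zero.  (Smallest column `c` with a nonzero weight, maximal run `c, c+d, …, c+Rd` of nonzero weights;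
`X + J^{(R+1)d}` is block upper triangular with the weighted `(R+2)`-cycle as a diagonal block, whose determinant is `± ∏ weights ≠ 0`.) -/
theorem eq_zero_of_diag_lines {b : ℕ} (X : Matrix (Fin b) (Fin b) ℂ) (d : ℕ) (hd : 1 ≤ d)
    (hsupp : ∀ i j : Fin b, X i j ≠ 0 → (i : ℕ) = j + d)
    (hX : ∀ a : ℕ, 1 ≤ a → (X + shiftPow ℂ b a) ^ b = 0) : X = 0 := by
  classical
  by_contra hne
  -- the weight of column `c` on the diagonal `d`
  let w : ℕ → ℂ := fun c => if h : c + d < b then X ⟨c + d, h⟩ ⟨c, by omega⟩ else 0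
  have hw_eq : ∀ c (h : c + d < b), w c = X ⟨c + d, h⟩ ⟨c, by omega⟩ := fun c h => by simp [w, h]
  have hw_of : ∀ c, w c ≠ 0 → c + d < b := fun c hc => by by_contra h; exact hc (by simp [w, h])
  -- entries of `X` are weights
  have hXw : ∀ i j : Fin b, X i j ≠ 0 → (j : ℕ) + d < b ∧ w j = X i j := by
    intro i j hij
    have h1 := hsupp i j hij
    have hlt : (j : ℕ) + d < b := by have := i.isLt; omega
    refine ⟨hlt, ?_⟩
    rw [hw_eq j hlt]
    congr 1; exact Fin.ext (by simp [h1])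
  have hex : ∃ c, w c ≠ 0 := by
    obtain ⟨i, j, hij⟩ : ∃ i j, X i j ≠ 0 := by
      by_contra h
      push Not at h
      exact hne (Matrix.ext fun i j => by rw [h i j]; rfl)
    exact ⟨j, by rw [(hXw i j hij).2]; exact hij⟩
  -- smallest column with a nonzero weight
  obtain ⟨c, hc, hmin⟩ : ∃ c, w c ≠ 0 ∧ ∀ c' < c, w c' = 0 :=
    ⟨Nat.find hex, Nat.find_spec hex, fun c' h => by simpa using Nat.find_min hex h⟩
  have hclass : ∀ x : ℕ, x % d = c % d → c ≤ x → ∃ q, x = c + q * d := by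
    intro x hx hcx
    have h0 : (x - c) % d = 0 := Nat.sub_mod_eq_zero_of_mod_eq hx
    obtain ⟨q, hq⟩ := Nat.dvd_of_mod_eq_zero h0
    exact ⟨q, by rw [mul_comm]; omega⟩
  -- the run `c, c+d, …, c+R·d` of nonzero weights, `w (c+(R+1)d) = 0`
  have hend : ∃ R, w (c + R * d + d) = 0 :=
    ⟨b, by
      have hb : ¬ (c + b * d + d + d < b) := by have := Nat.le_mul_of_pos_right b hd; omega
      simp [w, hb]⟩
  obtain ⟨R, hRend, hrun'⟩ : ∃ R, w (c + R * d + d) = 0 ∧ ∀ k < R, w (c + k * d + d) ≠ 0 :=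
    ⟨Nat.find hend, Nat.find_spec hend, fun k hk => Nat.find_min hend hk⟩
  have hrun : ∀ k, k ≤ R → w (c + k * d) ≠ 0 := by
    intro k hk
    rcases k with _ | k
    · simpa using hc
    · have := hrun' k (by omega)
      rwa [Nat.succ_mul, ← add_assoc]
  have hcR : c + (R + 1) * d < b := by
    have := hw_of _ (hrun R le_rfl); rw [Nat.succ_mul]; omega
  have hbpos : 0 < b := by omega
  -- labels: 0 = (other classes) ∪ (class of c below c), 1 = the run block, 2 = class of c above the block
  let labN : ℕ → ℕ := fun x => if x % d = c % d ∧ c ≤ x then (if x ≤ c + (R + 1) * d then 1 else 2) else 0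
  have hmono : ∀ x y : ℕ, x % d = y % d → x ≤ y → labN x ≤ labN y := by
    intro x y hxy hle
    simp only [labN]
    split_ifs <;> omega
  have hjump : ∀ x : ℕ, labN x < labN (x + d) → w x = 0 := by
    intro x hx
    have hxd : (x + d) % d = x % d := Nat.add_mod_right x d
    by_cases hxc : x < c
    · exact hmin x hxc
    push Not at hxc
    by_cases hcl : x % d = c % d
    · obtain ⟨q, hq⟩ := hclass x hcl hxc
      have hA : labN x = if x ≤ c + (R + 1) * d then 1 else 2 := by simp only [labN, if_pos (And.intro hcl hxc)]
      have hB : labN (x + d) = if x + d ≤ c + (R + 1) * d then 1 else 2 := by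
        simp only [labN, if_pos (And.intro (hxd.trans hcl) (le_trans hxc (Nat.le_add_right x d)))]
      rw [hA, hB] at hx
      have hx1 : x ≤ c + (R + 1) * d ∧ ¬ (x + d ≤ c + (R + 1) * d) := by
        constructor
        · by_contra h; rw [if_neg h] at hx; split_ifs at hx <;> omega
        · intro h; rw [if_pos h, if_pos (by omega)] at hx; omega
      -- hence q = R + 1 and x = c + (R+1) d
      have hq1 : q * d ≤ (R + 1) * d := by omega
      have hq2 : (R + 1) * d < (q + 1) * d := by have := add_one_mul q d; omega
      have hq3 : q = R + 1 := by
        have := Nat.le_of_mul_le_mul_right hq1 hd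
        have := Nat.lt_of_mul_lt_mul_right hq2
        omega
      rw [hq, hq3, Nat.succ_mul, ← add_assoc]
      exact hRend
    · exfalso
      have hA : labN x = 0 := by simp only [labN]; rw [if_neg]; exact fun h => hcl h.1
      have hB : labN (x + d) = 0 := by simp only [labN]; rw [if_neg]; exact fun h => hcl (hxd.symm.trans h.1)
      rw [hA, hB] at hx
      exact lt_irrefl _ hx
  let lab : Fin b → ℕ := fun i => labN i
  -- the shift by a = (R+1)·d
  set a := (R + 1) * d with ha_def
  have ha1 : 1 ≤ a := le_trans hd (by rw [ha_def, Nat.succ_mul]; omega)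
  set M := X + shiftPow ℂ b a with hM_def
  have hMb : M ^ b = 0 := hX a ha1
  have hBT : M.BlockTriangular lab := by
    intro i j hlt
    change labN j < labN i at hlt
    rw [hM_def, Matrix.add_apply]
    have hXij : X i j = 0 := by
      by_contra hx
      have hijd := hsupp i j hx
      have hw := (hXw i j hx).2
      have : labN (j : ℕ) < labN ((j : ℕ) + d) := by rw [← hijd]; exact hlt
      exact hx (by rw [← hw]; exact hjump _ this)
    have hJij : shiftPow ℂ b a i j = 0 := by
      rw [shiftPow_apply]
      split_ifs with h
      · exfalso
        have := hmono (i : ℕ) (j : ℕ) (by rw [h, ha_def, Nat.add_mul_mod_self_right]) (by omega)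
        omega
      · rfl
    rw [hXij, hJij, add_zero]
  -- the block
  let f : Fin (R + 1 + 1) → Fin b := fun k => ⟨c + k * d, by
    have hk : (k : ℕ) * d ≤ (R + 1) * d := Nat.mul_le_mul_right d (by have := k.isLt; omega)
    omega⟩
  have hf_val : ∀ k, (f k : ℕ) = c + k * d := fun k => rfl
  have hf_inj : Function.Injective f := by
    intro k k' h
    have h' : c + (k : ℕ) * d = c + k' * d := by rw [← hf_val, ← hf_val, h]
    have h'' : (k : ℕ) * d = k' * d := by omega
    exact Fin.ext (Nat.eq_of_mul_eq_mul_right (m := d) (by omega) h'')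
  have hf1 : ∀ k, lab (f k) = 1 := by
    intro k
    change labN (c + k * d) = 1
    have hk : (k : ℕ) * d ≤ (R + 1) * d := Nat.mul_le_mul_right d (by have := k.isLt; omega)
    simp only [labN, Nat.add_mul_mod_self_right, true_and]
    rw [if_pos (Nat.le_add_right _ _), if_pos (by omega)]
  have h1f : ∀ l, lab l = 1 → ∃ k, f k = l := by
    intro l hl
    change labN l = 1 at hl
    simp only [labN] at hl
    by_cases h1 : (l : ℕ) % d = c % d ∧ c ≤ (l : ℕ)
    · rw [if_pos h1] at hl
      have h2 : (l : ℕ) ≤ c + (R + 1) * d := by by_contra h; rw [if_neg h] at hl; omega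
      obtain ⟨q, hq⟩ := hclass l h1.1 h1.2
      have hqR : q ≤ R + 1 := Nat.le_of_mul_le_mul_right (by omega : q * d ≤ (R + 1) * d) hd
      exact ⟨⟨q, by omega⟩, Fin.ext (by rw [hf_val]; exact hq.symm)⟩
    · rw [if_neg h1] at hl; omega
  have hsub : ∀ s : ℕ, (M ^ s).submatrix f f = (M.submatrix f f) ^ s := by
    intro s
    induction s with
    | zero =>
      rw [pow_zero, pow_zero]
      ext p q
      simp only [submatrix_apply, Matrix.one_apply, hf_inj.eq_iff]
    | succ s ih =>
      rw [pow_succ, pow_succ, submatrix_mul_of_blockTriangular hf_inj hf1 h1f _ _ (hBT.pow s) hBT, ih]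
  -- the block is the weighted cycle: det ≠ 0
  let w' : Fin (R + 1 + 1) → ℂ := fun q => if (q : ℕ) ≤ R then w (c + q * d) else 1
  have hw' : ∀ q, w' q ≠ 0 := by
    intro q; simp only [w']; split_ifs with h
    · exact hrun q h
    · exact one_ne_zero
  have hBeq : M.submatrix f f = (diagonal w').submatrix (⇑(finRotate (R + 1 + 1)).symm) id := by
    ext p q
    rw [submatrix_apply, submatrix_apply, id, diagonal_apply, hM_def, Matrix.add_apply, shiftPow_apply, hf_val, hf_val]
    have hrot : ((finRotate (R + 1 + 1)) q : ℕ) = if q = Fin.last (R + 1) then 0 else (q : ℕ) + 1 := coe_finRotate q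
    by_cases h : (finRotate (R + 1 + 1)).symm p = q
    · rw [if_pos h, h]
      have hp : p = finRotate (R + 1 + 1) q := (Equiv.symm_apply_eq _).mp h
      by_cases hql : q = Fin.last (R + 1)
      · rw [if_pos hql] at hrot
        have hp0 : (p : ℕ) = 0 := by rw [hp]; exact hrot
        have hqv : (q : ℕ) = R + 1 := by rw [hql]; rfl
        have hX0 : X (f p) (f q) = 0 := by
          by_contra hx; have := hsupp _ _ hx; rw [hf_val, hf_val, hp0, hqv] at this; omega
        rw [hX0, zero_add, if_pos (by rw [hp0, hqv, ha_def]; ring)]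
        simp only [w', hqv]; rw [if_neg (by omega)]
      · rw [if_neg hql] at hrot
        have hp1 : (p : ℕ) = q + 1 := by rw [hp]; exact hrot
        have hqR : (q : ℕ) ≤ R := by have := p.isLt; omega
        have hlt : c + (q : ℕ) * d + d < b := hw_of _ (hrun q hqR)
        rw [if_neg (by rw [hp1, ha_def, Nat.succ_mul]; omega), add_zero]
        simp only [w']; rw [if_pos hqR, hw_eq _ hlt]
        rw [show f p = ⟨c + q * d + d, hlt⟩ from Fin.ext (by rw [hf_val, hp1]; ring)]
    · rw [if_neg h]
      have hp : p ≠ finRotate (R + 1 + 1) q := fun h' => h ((Equiv.symm_apply_eq _).mpr h')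
      have hX0 : X (f p) (f q) = 0 := by
        by_contra hx
        have h1 := hsupp _ _ hx
        rw [hf_val, hf_val] at h1
        have hp1 : (p : ℕ) = q + 1 := Nat.eq_of_mul_eq_mul_right (show 0 < d by omega) (by rw [Nat.succ_mul]; omega)
        apply hp; apply Fin.ext
        have hql : q ≠ Fin.last (R + 1) := by
          intro hq; have := p.isLt; rw [hq] at hp1; simp at hp1; omega
        rw [if_neg hql] at hrot; rw [hrot, hp1]
      rw [hX0, zero_add, if_neg]
      intro hJ
      have hq1 : (q : ℕ) = p + (R + 1) := Nat.eq_of_mul_eq_mul_right (show 0 < d by omega) (by rw [ha_def] at hJ; rw [add_mul]; omega)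
      have hp0 : (p : ℕ) = 0 := by have := q.isLt; omega
      have hql : q = Fin.last (R + 1) := Fin.ext (by rw [hq1, hp0]; simp)
      apply hp; apply Fin.ext
      rw [if_pos hql] at hrot; rw [hrot, hp0]
  have hdet_ne : (M.submatrix f f).det ≠ 0 := by
    rw [hBeq, Matrix.det_permute, det_diagonal]
    refine mul_ne_zero ?_ (Finset.prod_ne_zero_iff.mpr fun q _ => hw' q)
    rcases Int.units_eq_one_or (Equiv.Perm.sign (finRotate (R + 1 + 1)).symm) with h | h <;> simp [h]
  have hdet0 : (M.submatrix f f).det = 0 := by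
    have h := congrArg Matrix.det (hsub b)
    rw [hMb, det_pow] at h
    have h0 : ((0 : Matrix (Fin b) (Fin b) ℂ).submatrix f f).det = 0 := by
      rw [show ((0 : Matrix (Fin b) (Fin b) ℂ).submatrix f f) = 0 from rfl]; exact det_zero
    rw [h0] at h
    exact (pow_eq_zero_iff (by omega)).mp h.symm
  exact hdet_ne hdet0

/-! ## The structure theorem -/

/-- One induction step: if everything strictly below the diagonal `d` vanishes, so does the diagonal `d` (`d ≥ 0`;
`d = 0` is the main diagonal). -/
theorem diag_step {b : ℕ} (A : Matrix (Fin b) (Fin b) ℂ) (d : ℕ)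
    (hdeep : ∀ i j : Fin b, (j : ℕ) + d < i → A i j = 0)
    (hA : ∀ a : ℕ, 1 ≤ a → ∀ t : ℂ, (A + t • shiftPow ℂ b a) ^ b = 0) :
    ∀ i j : Fin b, (j : ℕ) + d ≤ i → A i j = 0 := by
  have hX := diagPart_lines A d hdeep hA
  have hzero : diagPart A d = 0 := by
    rcases Nat.eq_zero_or_pos d with rfl | hdpos
    · have h0 := hX 1 le_rfl 0
      rw [zero_smul, add_zero] at h0
      have hdiag : diagPart A 0 = diagonal (fun i => A i i) := by
        ext i j; rw [diagPart_apply, diagonal_apply]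
        by_cases h : i = j
        · subst h; simp
        · rw [if_neg (fun h' => h (Fin.ext (by omega))), if_neg h]
      rw [hdiag, diagonal_pow] at h0
      rw [hdiag]
      ext i j
      rw [diagonal_apply, Matrix.zero_apply]
      split_ifs with h
      · have := congrArg (fun M => M i i) h0
        simp only [diagonal_apply_eq, Pi.pow_apply, Matrix.zero_apply] at this
        exact (pow_eq_zero_iff (by have := i.isLt; omega)).mp this
      · rfl
    · refine eq_zero_of_diag_lines (diagPart A d) d hdpos (fun i j h => ?_) (fun a ha => by simpa using hX a ha 1)
      rw [diagPart_apply] at h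
      by_contra h'
      exact h (if_neg h')
  intro i j hji
  rcases Nat.lt_or_eq_of_le hji with hlt | heq
  · exact hdeep i j hlt
  · have := congrArg (fun M => M i j) hzero
    simp only [diagPart_apply, Matrix.zero_apply, if_pos heq.symm] at this
    exact this

/-- ★ **Line-wise Gerstenhaber all-powers theorem** (power-vanishing form).  If for every `a ≥ 1` and every `t ∈ ℂ` the matrix
`A + t·J^a` satisfies `(A + t·J^a)^b = 0` (`J = shiftPow ℂ b 1` the principal nilpotent, `J^a = shiftPow ℂ b a` by `shiftPow_eq_pow`),
then `A` is strictly upper triangular.  Only the LINES through `A` in the directions `J^a` are used. [this file] -/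
theorem strictUpper_of_lines {b : ℕ} (A : Matrix (Fin b) (Fin b) ℂ)
    (hA : ∀ a : ℕ, 1 ≤ a → ∀ t : ℂ, (A + t • shiftPow ℂ b a) ^ b = 0) :
    ∀ i j : Fin b, j ≤ i → A i j = 0 := by
  suffices H : ∀ s : ℕ, ∀ i j : Fin b, (j : ℕ) + (b - s) ≤ i → A i j = 0 by
    intro i j hji
    exact H b i j (by rw [Nat.sub_self, add_zero]; exact hji)
  intro s
  induction s with
  | zero => intro i j h; have := i.isLt; omega
  | succ s ih =>
    by_cases hs : b - s = 0
    · intro i j h; exact ih i j (by omega)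
    · have hd1 : b - s = (b - (s + 1)) + 1 := by omega
      rw [hd1] at ih
      exact diag_step A (b - (s + 1)) (fun i j h => ih i j (by omega)) hA

/-- Over `ℂ`, a nilpotent `b × b` matrix has vanishing `b`-th power (charpoly `= X^b` + Cayley–Hamilton). [Mathlib glue] -/
theorem pow_eq_zero_of_isNilpotent {b : ℕ} {M : Matrix (Fin b) (Fin b) ℂ} (h : IsNilpotent M) : M ^ b = 0 := by
  have h1 := Matrix.isNilpotent_charpoly_sub_pow_of_isNilpotent h
  have h2 : M.charpoly - X ^ (Fintype.card (Fin b)) = 0 := h1.eq_zero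
  rw [sub_eq_zero, Fintype.card_fin] at h2
  have h3 := Matrix.aeval_self_charpoly M
  rw [h2] at h3
  simpa using h3

/-- ★ **Line-wise Gerstenhaber all-powers theorem.**  If `A + t·J^a` is nilpotent for every `t ∈ ℂ` and every `a ≥ 1`
(`J^a = shiftPow ℂ b a`, the powers of the principal nilpotent `J = Σ E_{i,i+1}`), then `A` is strictly upper triangular in the
SAME basis.  Corollary (Gerstenhaber 1958 Thm 2 / Mathes–Omladič–Radjavi 1991 §4): a nilpotent linear space containing every power of
a principal nilpotent is triangularised by that nilpotent's Jordan flag. [this file] -/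
theorem strictUpper_of_nilpotent_lines {b : ℕ} (A : Matrix (Fin b) (Fin b) ℂ)
    (hA : ∀ a : ℕ, 1 ≤ a → ∀ t : ℂ, IsNilpotent (A + t • shiftPow ℂ b a)) :
    ∀ i j : Fin b, j ≤ i → A i j = 0 :=
  strictUpper_of_lines A (fun a ha t => pow_eq_zero_of_isNilpotent (hA a ha t))

/-! ## Conjugate form and the (c)-row -/

/-- Nilpotency is invariant under conjugation by a unit. [folklore] -/
theorem isNilpotent_conj {b : ℕ} (P : (Matrix (Fin b) (Fin b) ℂ)ˣ) {M : Matrix (Fin b) (Fin b) ℂ} (h : IsNilpotent M) :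
    IsNilpotent ((P : Matrix (Fin b) (Fin b) ℂ) * M * (↑P⁻¹ : Matrix (Fin b) (Fin b) ℂ)) := by
  obtain ⟨k, hk⟩ := h
  refine ⟨k, ?_⟩
  have hPP : (↑P⁻¹ : Matrix (Fin b) (Fin b) ℂ) * (P : Matrix (Fin b) (Fin b) ℂ) = 1 := Units.inv_mul P
  have : ∀ s : ℕ, ((P : Matrix (Fin b) (Fin b) ℂ) * M * (↑P⁻¹ : Matrix (Fin b) (Fin b) ℂ)) ^ s
      = (P : Matrix (Fin b) (Fin b) ℂ) * M ^ s * (↑P⁻¹ : Matrix (Fin b) (Fin b) ℂ) := by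
    intro s
    induction s with
    | zero => rw [pow_zero, pow_zero, Matrix.mul_one, Units.mul_inv]
    | succ s ih =>
      rw [pow_succ, ih, pow_succ]
      simp only [Matrix.mul_assoc]
      congr 1
      rw [← Matrix.mul_assoc (↑P⁻¹ : Matrix (Fin b) (Fin b) ℂ), hPP, Matrix.one_mul, ← Matrix.mul_assoc]
  rw [this, hk, Matrix.mul_zero, Matrix.zero_mul]

/-- ★ **Conjugate form.**  Let `Q = P⁻¹·J·P` be ANY principal nilpotent (a single nilpotent Jordan block, written through its
Jordan basis `P`).  If `A + t·Q^a` is nilpotent for all `t ∈ ℂ`, `a ≥ 1`, then `P·A·P⁻¹` is strictly upper triangular: `A` is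
triangularised by the Jordan flag of `Q`. [this file] -/
theorem conj_strictUpper_of_nilpotent_lines {b : ℕ} (P : (Matrix (Fin b) (Fin b) ℂ)ˣ) (A : Matrix (Fin b) (Fin b) ℂ)
    (hA : ∀ a : ℕ, 1 ≤ a → ∀ t : ℂ,
      IsNilpotent (A + t • ((↑P⁻¹ : Matrix (Fin b) (Fin b) ℂ) * shiftPow ℂ b a * (P : Matrix (Fin b) (Fin b) ℂ)))) :
    ∀ i j : Fin b, j ≤ i → ((P : Matrix (Fin b) (Fin b) ℂ) * A * (↑P⁻¹ : Matrix (Fin b) (Fin b) ℂ)) i j = 0 := by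
  apply strictUpper_of_nilpotent_lines
  intro a ha t
  have h := isNilpotent_conj P (hA a ha t)
  have hPP : (P : Matrix (Fin b) (Fin b) ℂ) * (↑P⁻¹ : Matrix (Fin b) (Fin b) ℂ) = 1 := Units.mul_inv P
  have e : (P : Matrix (Fin b) (Fin b) ℂ) * (A + t • ((↑P⁻¹ : Matrix (Fin b) (Fin b) ℂ) * shiftPow ℂ b a *
      (P : Matrix (Fin b) (Fin b) ℂ))) * (↑P⁻¹ : Matrix (Fin b) (Fin b) ℂ)
      = (P : Matrix (Fin b) (Fin b) ℂ) * A * (↑P⁻¹ : Matrix (Fin b) (Fin b) ℂ) + t • shiftPow ℂ b a := by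
    rw [Matrix.mul_add, Matrix.add_mul, Matrix.mul_smul, Matrix.smul_mul]
    congr 2
    calc (P : Matrix (Fin b) (Fin b) ℂ) * ((↑P⁻¹ : Matrix (Fin b) (Fin b) ℂ) * shiftPow ℂ b a * (P : Matrix (Fin b) (Fin b) ℂ))
          * (↑P⁻¹ : Matrix (Fin b) (Fin b) ℂ)
        = ((P : Matrix (Fin b) (Fin b) ℂ) * (↑P⁻¹ : Matrix (Fin b) (Fin b) ℂ)) * shiftPow ℂ b a *
          ((P : Matrix (Fin b) (Fin b) ℂ) * (↑P⁻¹ : Matrix (Fin b) (Fin b) ℂ)) := by simp only [Matrix.mul_assoc]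
      _ = shiftPow ℂ b a := by rw [hPP, Matrix.one_mul, Matrix.mul_one]
  rwa [e] at h

/-- ★ **The SPACE corollary (Gerstenhaber / MOR §4, all-powers form).**  If a set `V` of matrices is closed under adding multiples of
the powers `Q^a` (`a ≥ 1`) of one principal nilpotent `Q = P⁻¹JP` and consists of nilpotents, then `P` conjugates every element of `V`
into the strictly upper triangular matrices. [this file] -/
theorem space_triangularised_by_principal_powers {b : ℕ} (P : (Matrix (Fin b) (Fin b) ℂ)ˣ) (V : Set (Matrix (Fin b) (Fin b) ℂ))
    (hnil : ∀ A ∈ V, IsNilpotent A)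
    (hline : ∀ A ∈ V, ∀ a : ℕ, 1 ≤ a → ∀ t : ℂ,
      A + t • ((↑P⁻¹ : Matrix (Fin b) (Fin b) ℂ) * shiftPow ℂ b a * (P : Matrix (Fin b) (Fin b) ℂ)) ∈ V) :
    ∀ A ∈ V, ∀ i j : Fin b, j ≤ i → ((P : Matrix (Fin b) (Fin b) ℂ) * A * (↑P⁻¹ : Matrix (Fin b) (Fin b) ℂ)) i j = 0 :=
  fun A hA => conj_strictUpper_of_nilpotent_lines P A (fun a ha t => hnil _ (hline A hA a ha t))

open Summit.ValiantsHypothesis.ValiantsHypothesis.Cruxes.TwoDimCoefficients.DimTwoCases (AffMat IsAffine)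
open Summit.ValiantsHypothesis.ValiantsHypothesis.Theorems.GrenetZeon.SlowCore
open Summit.ValiantsHypothesis.ValiantsHypothesis.Theorems.GrenetZeon.TriangularRow (relCert_of_values_triangularisable)

/-- ★ **Row r6 (all-powers half) in (c)'s currency.**  An affine pencil `N` whose every value `N(x)` stays nilpotent along every line in
the direction of every power `Q^a` (`a ≥ 1`) of ONE principal nilpotent `Q = P⁻¹JP` — e.g. because the affine value space contains
`N(x) + ℂ[Q]Q` — is simultaneously strictly-upper-triangularised by `P` (`conj_strictUpper_of_nilpotent_lines`), hence (c)-CHEAP: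
`RelCert n m N (3·(⌊√n⌋·m))` by ✓ `Theorems.GrenetZeon.TriangularRow.relCert_of_values_triangularisable` (g6 row r2, ported to Theorems/…LongMassTriangular.lean).  A (c)-violator family therefore never contains all
powers of a principal nilpotent in its direction space (discard test D6 / crit-7 row r6, all-powers half; the Omladič `J, J²` half is NOT
covered). [this file] -/
theorem relCert_of_principal_powers {n m : ℕ} (N : AffMat n m) (hN : IsAffine N) (P : (Matrix (Fin m) (Fin m) ℂ)ˣ)
    (hP : ∀ x : Fin n × Fin n → ℂ, ∀ a : ℕ, 1 ≤ a → ∀ t : ℂ,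
      IsNilpotent (N.map (MvPolynomial.eval x) +
        t • ((↑P⁻¹ : Matrix (Fin m) (Fin m) ℂ) * shiftPow ℂ m a * (P : Matrix (Fin m) (Fin m) ℂ)))) :
    RelCert n m N (3 * (Nat.sqrt n * m)) :=
  relCert_of_values_triangularisable N hN
    {A | ∀ a : ℕ, 1 ≤ a → ∀ t : ℂ,
      IsNilpotent (A + t • ((↑P⁻¹ : Matrix (Fin m) (Fin m) ℂ) * shiftPow ℂ m a * (P : Matrix (Fin m) (Fin m) ℂ)))}
    hP P (fun A hA => conj_strictUpper_of_nilpotent_lines P A hA)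

/-- The same row with `P = 1` (the pencil's values are tested against the powers of the standard `J` itself). [this file] -/
theorem relCert_of_shift_powers {n m : ℕ} (N : AffMat n m) (hN : IsAffine N)
    (hJ : ∀ x : Fin n × Fin n → ℂ, ∀ a : ℕ, 1 ≤ a → ∀ t : ℂ, IsNilpotent (N.map (MvPolynomial.eval x) + t • shiftPow ℂ m a)) :
    RelCert n m N (3 * (Nat.sqrt n * m)) := by
  refine relCert_of_principal_powers N hN 1 (fun x a ha t => ?_)
  simpa using hJ x a ha t

end Summit.ValiantsHypothesis.ValiantsHypothesis.Cruxes.DualUnipotentThreeHalves.PrincipalPowers
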